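import Summits.QuantumFields.BalabanUV.T4Continuum.Support.ShellMeasureExpHaarSU2Chart
import Summits.QuantumFields.BalabanUV.T4Continuum.Support.ShellMeasureRealizedSUN

/-!
# `T4Continuum.ShellMeasureExpHaarSU2` — (CH)₁ AT THE CERTIFIED INSTANCE `N = 2`: the one-bond exponential chart identity
# of the `SU(N)` engine is a THEOREM for `SU(2)`, and the `SU(N)` engine at `N = 2` has no input beyond the `SU(2)` road's
(cell `pub-balaban`, sub-cell `t4`, spine estimate NE7c (node U5b); NE7c formalisation swarm, crew seat
`b2b-balaban-t4-ne7c-formalise-leaf-09` gen 5; row S3 «SM-L9 SU(N) chart» of `t4/b2b-balaban-t4-ne7c-p1/LEAVES-NE7c-P1.md`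
(trigger `t4/T4-NE7c-TRIGGER.json`, c5: optional and last) — file 2/2 of «(CH)₁ at the certified instance `N = 2`»: the
located input (CH)₁ of GAPS G-ne7cL04-1, MEASURE HALF, at `N = 2`; imports file 1/2 `ShellMeasureExpHaarSU2Chart` and S3
file 5 `ShellMeasureRealizedSUN` (p209487) ONLY; ADDITIVE, modifies nothing; 0 `def … : Prop`, 0 sorry, 0 citations)

HONEST FRAMING.  Finite four-torus programme, rung (B)+1 only — NOT infinite volume, NOT a mass gap, NOT the Clay
problem, NOT summit progress; (B), `BetaPertHyp`, (B^μ) not consumed.  NE7c (`T4IndicatorShell.ShellWeightBound`) is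
NOT PRINTED and NOT PROVED; «NE7c ⇐ the named binders».  Nothing printed in [Balaban 1983–89] is read or asserted here:
this file is classical measure theory on `SU(2)` (Haar measure in exponential coordinates); every declaration is
[folklore].  (CH)₁ for `N ≥ 3` (the exponential-coordinates Haar density of `SU(N)`; Helgason GGA V §1 Thm 1.10 is the
LOCATOR in S3 file 5, not a citation) stays DISPLAYED — it needs `d exp_X = (1 − e^{−ad X})/ad X` and its determinant,
not in the tree or Mathlib.

WHY THIS FILE.  Row S3's `SU(N)` engine `ShellMeasureRealizedSUN.slotAntiConcentration_realized_suN_expJac` has EXACTLY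
ONE located binder beyond the `SU(2)` road (referee passes 3–6; typer DAG row S3): the one-bond chart identity

  (CH)₁  `Haar_{SU(N)}|_{expPtSU(B̄_S)} = (expPtSU)_* (vol_{E_N}|_{B̄_S} · κ · expJacSU)`,   `0 ≤ S ≤ π`,

typed with the tree's ARBITRARY orthonormal coordinates `coordSU : E_N ≃ₗᵢ 𝔰𝔲(N)` (Hilbert–Schmidt), the
discriminant-quotient Jacobian `expJacSU` and a free constant `κ`.  Its set-theoretic half (injectivity of the chart on
`S < π`) is kernel (S3 file 6 `ShellMeasureExpInjectiveSUN`); its measure half was displayed for EVERY `N`, including the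
row's certified instance `N = 2` — where the tree DOES hold the classical formula, in quaternion coordinates:
`T4HaarSU2ExpChart.haarProbability_restrict_image` (`Haar|_{exp(ι A)} = (expPoint)_*((2π²)⁻¹ sinc²‖x‖ 1_A d³x)`,
`A ⊆ {‖x‖ < π} ⊆ ℝ³`).  This file TRANSPORTS that formula along file 1's dictionary `chartE3 : ℝ³ ≃ₗ E_2`
(`expPtSU ∘ chartE3 = expPoint`, `‖chartE3 x‖ = √2‖x‖`, `expJacSU v = sinc²(‖v‖/√2)`) and so CHECKS THE TYPING of
(CH)₁ in kernel at `N = 2` — a mis-normalised `κ`, a wrong window or a wrong Jacobian convention would have surfaced as a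
false statement; none did:
* §3 measure transport: `isoE3 = (√2)⁻¹·chartE3 : ℝ³ ≃ₗᵢ E_2`; **`map_chartE3_volume`**: `(chartE3)_* vol_{ℝ³} =
  2^{−3/2} · vol_{E_2}` (isometry + homothety of ratio `√2` in dimension `3`); the transported window `chartE3⁻¹(B̄_S)`
  lies in the injectivity ball `‖x‖ < π` when `S < √2·π`; and the quaternion chart law pushed by `chartE3` IS the chart
  law of (CH)₁ with **`κ₂ = 2^{−3/2}(2π²)⁻¹`** (`map_chartE3_expMeasure`; the densities agree off the origin,
  `density_transport`, and the origin is Lebesgue-null, `ae_ne_zero_chartSU_two`).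
* §4 **`hCH_two_of_lt`** (every `S < √2·π`) and **`hCH_two`** (`S ≤ π`, the binder's own range): (CH)₁ at `N = 2` —
  LITERALLY the hypothesis `hCH` of `ShellMeasureScalingSUN.chart_suN` / `…RealizedSUN.slotAntiConcentration_realized_
  suN_expJac` at `N = 2`, `κ := κ₂` — PROVED; `example`: the Haar mass of the window as the chart integral.
* §5 **`slotAntiConcentration_realized_suTwo_expJac`**: the `SU(N)` engine at `N = 2` with `hCH` SUPPLIED by `hCH_two`
  — its remaining binders are the data every member carries (`hFw`, `hfin`, numbers, (S-i) `hcore`, (S-ii) `hden`),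
  i.e. the `SU(2)` road's list up to the chart shape (HS-ball of `E_2` in place of the sup-norm cube of
  `ShellMeasureScalingSU2`): at the certified instance the `SU(N)` road has NO input beyond the `SU(2)` road's.

WHAT THIS DOES NOT DO.  (CH)₁ for `N ≥ 3`; any instance of (S-i)/(S-ii), SM-L1…L8, (LR), (MR), (W1), the (F∞)-rate for
Bałaban's measures; nothing in the countdown moves (spine PROVED 0/9).  HONEST DEPENDENCY (cell): continuum YM on T⁴ ⇐
BetaPertH ∧ nine spine estimates (0/9 proved); BetaPertH ⇐ (D1) ∧ (D4) ∧ CAP+tail; G-an2-4 gates asym, D1 and NE2/3/4.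
-/

noncomputable section

namespace Summit.QuantumFields.BalabanUV.T4Continuum.ShellMeasureExpHaarSU2

open MeasureTheory Set Function Metric NormedSpace
open scoped ENNReal
open Literature.MathematicalPhysics.QuantumFieldTheory.Balaban1983to89
open T4HaarSU2ExpChart (expPoint expWeight expMeasure haarProbability_restrict_image measurable_expWeight
  expWeight_nonneg)
open T4ShellMeasure (SlotAntiConcentration)
open T4ShellMeasureDet (blockLaw)
open ShellMeasureExpChartSUN ShellMeasureExpJacobianSUN ShellMeasureScalingSUN ShellMeasureRealizedSUN
open ShellMeasureExpHaarSU2Chart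

/-! ## §3 Measure transport: Lebesgue measure and the quaternion chart law in the `𝔰𝔲(2)` coordinates -/

/-- THE NORMALISING CONSTANT OF (CH)₁ AT `N = 2`: `κ₂ = 2^{−3/2} · (2π²)⁻¹` (the factor `2^{−3/2}` is the Lebesgue
Jacobian of `ℝ³ → E_2`, `x ↦ coordSU⁻¹ (quatMatrix (ι x))`, which scales norms by `√2`). [folklore] -/
def kappaTwo : ℝ≥0∞ := ENNReal.ofReal ((Real.sqrt 2 ^ 3)⁻¹ * (2 * Real.pi ^ 2)⁻¹)

/-- `chartE3` is continuous. [folklore] -/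
theorem continuous_chartE3 : Continuous (chartE3 : E3 → ChartSU 2) :=
  LinearMap.continuous_of_finiteDimensional (chartE3 : E3 →ₗ[ℝ] ChartSU 2)

/-- `chartE3` is measurable. [folklore] -/
theorem measurable_chartE3 : Measurable (chartE3 : E3 → ChartSU 2) := continuous_chartE3.measurable

/-- `chartE3⁻¹` is continuous. [folklore] -/
theorem continuous_chartE3_symm : Continuous (chartE3.symm : ChartSU 2 → E3) :=
  LinearMap.continuous_of_finiteDimensional (chartE3.symm : ChartSU 2 →ₗ[ℝ] E3)

/-- THE ISOMETRY `(√2)⁻¹ · chartE3 : ℝ³ ≃ E_2` (linear, norm-preserving). [folklore] -/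
def isoE3 : E3 ≃ₗᵢ[ℝ] ChartSU 2 where
  toLinearEquiv := chartE3.trans (LinearEquiv.smulOfNeZero ℝ (ChartSU 2) (Real.sqrt 2)⁻¹ (by positivity))
  norm_map' x := by
    show ‖(Real.sqrt 2)⁻¹ • chartE3 x‖ = ‖x‖
    have hs : (0 : ℝ) < Real.sqrt 2 := Real.sqrt_pos.mpr two_pos
    rw [norm_smul, norm_inv, Real.norm_of_nonneg hs.le, norm_chartE3]
    field_simp

/-- `isoE3 x = (√2)⁻¹ • chartE3 x`. [folklore] -/
theorem isoE3_apply (x : E3) : isoE3 x = (Real.sqrt 2)⁻¹ • chartE3 x := rfl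

/-- `chartE3 x = √2 • isoE3 x`. [folklore] -/
theorem chartE3_eq_smul_isoE3 (x : E3) : chartE3 x = Real.sqrt 2 • isoE3 x := by
  have hs : Real.sqrt 2 ≠ 0 := (Real.sqrt_pos.mpr two_pos).ne'
  rw [isoE3_apply, smul_smul, mul_inv_cancel₀ hs, one_smul]

/-- `dim_ℝ E_2 = 3`. [folklore] -/
theorem finrank_chartSU_two : Module.finrank ℝ (ChartSU 2) = 3 := by
  rw [show Module.finrank ℝ (ChartSU 2) = dimSU 2 from finrank_euclideanSpace_fin, dimSU_two]

/-- **LEBESGUE MEASURE TRANSPORT**: `(chartE3)_* vol_{ℝ³} = 2^{−3/2} · vol_{E_2}` (an isometry followed by the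
homothety of ratio `√2` in dimension `3`). [folklore] -/
theorem map_chartE3_volume :
    (volume : Measure E3).map chartE3 = ENNReal.ofReal ((Real.sqrt 2 ^ 3)⁻¹) • (volume : Measure (ChartSU 2)) := by
  have hs : (0 : ℝ) < Real.sqrt 2 := Real.sqrt_pos.mpr two_pos
  have h1 : (chartE3 : E3 → ChartSU 2) = (fun v : ChartSU 2 => Real.sqrt 2 • v) ∘ isoE3 :=
    funext chartE3_eq_smul_isoE3
  rw [h1, ← Measure.map_map (measurable_const_smul (Real.sqrt 2)) isoE3.continuous.measurable,
    isoE3.measurePreserving.map_eq, Measure.map_addHaar_smul volume hs.ne', finrank_chartSU_two,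
    abs_of_pos (inv_pos.mpr (pow_pos hs 3))]

/-- the transported window `chartE3⁻¹(B̄_S)` lies in the injectivity ball `‖x‖ < π` of the quaternion chart as soon as
`S < √2·π`. [folklore] -/
theorem chartE3_preimage_closedBall_subset {S : ℝ} (hS : S < Real.sqrt 2 * Real.pi) :
    chartE3 ⁻¹' closedBall (0 : ChartSU 2) S ⊆ ball (0 : E3) Real.pi := by
  intro x hx
  rw [mem_preimage, mem_closedBall_zero_iff, norm_chartE3] at hx
  rw [mem_ball_zero_iff]
  have hs : (0 : ℝ) < Real.sqrt 2 := Real.sqrt_pos.mpr two_pos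
  nlinarith

/-- `E_2` is a nontrivial space (so that its Lebesgue measure has no atoms). [folklore] -/
instance nontrivial_chartSU_two : Nontrivial (ChartSU 2) := chartE3.injective.nontrivial

/-- Lebesgue-almost every point of `E_2` is non-zero. [folklore] -/
theorem ae_ne_zero_chartSU_two : ∀ᵐ v ∂(volume : Measure (ChartSU 2)), v ≠ 0 := by
  rw [ae_iff]
  simp only [not_not, setOf_eq_eq_singleton, measure_singleton]

/-- the two densities agree off the origin: `2^{−3/2} · w_exp(chartE3⁻¹ v) = κ₂ · expJacSU v` for `v ≠ 0`. [folklore] -/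
theorem density_transport {v : ChartSU 2} (hv : v ≠ 0) :
    ENNReal.ofReal ((Real.sqrt 2 ^ 3)⁻¹) * ENNReal.ofReal (expWeight (chartE3.symm v)) = expJacWeightSU kappaTwo v := by
  unfold expJacWeightSU kappaTwo expWeight
  rw [norm_chartE3_symm, expJacSU_two hv, ← ENNReal.ofReal_mul (by positivity), ← ENNReal.ofReal_mul (by positivity),
    mul_assoc]

/-- **THE QUATERNION CHART LAW IN THE `𝔰𝔲(2)` COORDINATES**: for `S < √2·π`, the push-forward under `chartE3` of the tree's
exponential chart law `μ_exp = (2π²)⁻¹ sinc²‖x‖ 1_{‖x‖<π} d³x` restricted to `chartE3⁻¹(B̄_S)` IS the chart-side law of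
(CH)₁, `(vol|_{B̄_S}) · κ₂ · expJacSU`. [folklore] -/
theorem map_chartE3_expMeasure {S : ℝ} (hS : S < Real.sqrt 2 * Real.pi) :
    (expMeasure.restrict (chartE3 ⁻¹' closedBall (0 : ChartSU 2) S)).map chartE3 =
      ((volume : Measure (ChartSU 2)).restrict (closedBall 0 S)).withDensity (expJacWeightSU kappaTwo) := by
  set A := chartE3 ⁻¹' closedBall (0 : ChartSU 2) S with hAdef
  have hA : MeasurableSet A := measurableSet_closedBall.preimage measurable_chartE3
  have hAπ : A ⊆ ball 0 Real.pi := chartE3_preimage_closedBall_subset hS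
  have h1 : expMeasure.restrict A =
      ((volume : Measure E3).restrict A).withDensity fun x => ENNReal.ofReal (expWeight x) := by
    rw [expMeasure, restrict_withDensity hA, Measure.restrict_restrict hA, inter_eq_left.mpr hAπ]
  rw [h1]
  set g : ChartSU 2 → ℝ≥0∞ := fun v => ENNReal.ofReal (expWeight (chartE3.symm v)) with hgdef
  have hg : Measurable g :=
    (measurable_expWeight.comp continuous_chartE3_symm.measurable).ennreal_ofReal
  have hfg : (fun x : E3 => ENNReal.ofReal (expWeight x)) = fun x => g (chartE3 x) := by
    funext x
    rw [hgdef]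
    simp only [LinearEquiv.symm_apply_apply]
  ext B hB
  have hT : MeasurableSet (B ∩ closedBall (0 : ChartSU 2) S) := hB.inter measurableSet_closedBall
  have hset : chartE3 ⁻¹' B ∩ A = chartE3 ⁻¹' (B ∩ closedBall 0 S) := by rw [hAdef, ← preimage_inter]
  rw [Measure.map_apply measurable_chartE3 hB, withDensity_apply _ (measurable_chartE3 hB), withDensity_apply _ hB,
    Measure.restrict_restrict (measurable_chartE3 hB), Measure.restrict_restrict hB, hset, hfg,
    ← setLIntegral_map hT hg measurable_chartE3, map_chartE3_volume, Measure.restrict_smul, lintegral_smul_measure,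
    smul_eq_mul, ← lintegral_const_mul _ hg]
  refine setLIntegral_congr_fun_ae hT ?_
  filter_upwards [ae_ne_zero_chartSU_two] with v hv _
  rw [hgdef]
  exact density_transport hv

/-! ## §4 (CH)₁ at `N = 2`: the one-bond exponential chart identity, DISCHARGED -/

/-- the (CH)₁ window at `N = 2` IS a quaternion chart window: `expBallSU S = expPoint '' chartE3⁻¹(B̄_S)`. [folklore] -/
theorem expBallSU_two_eq (S : ℝ) :
    expBallSU (N := 2) S = expPoint '' (chartE3 ⁻¹' closedBall (0 : ChartSU 2) S) := by
  unfold expBallSU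
  rw [expPoint_eq_comp, image_comp, image_preimage_eq _ chartE3.surjective]

/-- **(CH)₁ AT `N = 2`, GENERAL WINDOW `S < √2·π`.**  The normalised Haar measure of `SU(2)` restricted to the
exponential window `exp(B̄_S)` (`B̄_S` the closed Hilbert–Schmidt ball of `𝔰𝔲(2)`, read in the tree's orthonormal
coordinates `E_2`) is the push-forward under `expPtSU` of `κ₂ · expJacSU · vol|_{B̄_S}`, `κ₂ = 2^{−3/2}(2π²)⁻¹` — the
binder `hCH` of `ShellMeasureScalingSUN.chart_suN` / `ShellMeasureRealizedSUN.slotAntiConcentration_realized_suN_expJac`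
at `N = 2`, PROVED (from `T4HaarSU2ExpChart.haarProbability_restrict_image` by the coordinate change `chartE3`).
[folklore] -/
theorem hCH_two_of_lt {S : ℝ} (hS : S < Real.sqrt 2 * Real.pi) :
    (HaarData.haar : Measure (SUN 2)).restrict (expBallSU S) =
      (((volume : Measure (ChartSU 2)).restrict (closedBall 0 S)).withDensity (expJacWeightSU kappaTwo)).map
        expPtSU := by
  have hA : MeasurableSet (chartE3 ⁻¹' closedBall (0 : ChartSU 2) S) :=
    measurableSet_closedBall.preimage measurable_chartE3
  have hAπ : chartE3 ⁻¹' closedBall (0 : ChartSU 2) S ⊆ ball 0 Real.pi := chartE3_preimage_closedBall_subset hS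
  rw [expBallSU_two_eq, show (HaarData.haar : Measure (SUN 2)) =
      Literature.MathematicalPhysics.QuantumFieldTheory.haarProbability (Matrix.specialUnitaryGroup (Fin 2) ℂ) from rfl,
    haarProbability_restrict_image hA hAπ, expPoint_eq_comp,
    ← Measure.map_map measurable_expPtSU measurable_chartE3, map_chartE3_expMeasure hS]

/-- **(CH)₁ AT `N = 2` IN THE BINDER'S OWN RANGE `0 ≤ S ≤ π`** (`π < √2·π`). [folklore] -/
theorem hCH_two {S : ℝ} (hS : S ≤ Real.pi) :
    (HaarData.haar : Measure (SUN 2)).restrict (expBallSU S) =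
      (((volume : Measure (ChartSU 2)).restrict (closedBall 0 S)).withDensity (expJacWeightSU kappaTwo)).map
        expPtSU := by
  refine hCH_two_of_lt (hS.trans_lt ?_)
  have h1 : (1 : ℝ) < Real.sqrt 2 := by
    rw [show (1 : ℝ) = Real.sqrt 1 from Real.sqrt_one.symm]
    exact Real.sqrt_lt_sqrt zero_le_one one_lt_two
  nlinarith [Real.pi_pos]

/-- the total mass check: `κ₂ · ∫_{E_2} expJacSU dv ≥ Haar(exp B̄_π) = 1`-type identities are not needed; what (CH)₁
gives for free is that the chart-side law of the full window `S = π` is a PROBABILITY law pushed to all of `SU(2)`: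
`Haar(expBallSU π) = 1` (the quaternion chart covers `SU(2)` up to a null set already at HS-radius `√2·π`; at
radius `π` the window is proper — recorded here only as the measure identity, no mass is asserted). [folklore] -/
example {S : ℝ} (hS : S ≤ Real.pi) :
    (HaarData.haar : Measure (SUN 2)) (expBallSU S) =
      ∫⁻ v in closedBall (0 : ChartSU 2) S, expJacWeightSU kappaTwo v := by
  have h := congrArg (fun μ : Measure (SUN 2) => μ univ) (hCH_two hS)
  simp only [Measure.restrict_apply MeasurableSet.univ, univ_inter,
    Measure.map_apply measurable_expPtSU MeasurableSet.univ, preimage_univ,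
    withDensity_apply _ MeasurableSet.univ, Measure.restrict_univ] at h
  exact h

/-! ## §5 The `SU(N)` engine at `N = 2` with (CH)₁ discharged -/

section Engine

variable {P : Params} {j : ℕ} [DecidableEq (PBond P j)]

/-- **THE REALIZED `SU(N)` ENGINE AT `N = 2`, UNCONDITIONAL IN (CH)₁.**  LITERALLY
`ShellMeasureRealizedSUN.slotAntiConcentration_realized_suN_expJac` at `N = 2`, `κ := κ₂`, with its located binder
`hCH` SUPPLIED by `hCH_two`: the remaining hypotheses are the data every member carries (window factorisation `hFw`,
per-section finiteness `hfin`, numbers, (S-i) `hcore`, (S-ii) `hden` on the block weight alone) — exactly the binder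
list of the `SU(2)` engine `ShellMeasureScalingSU2` up to the chart (HS-ball of `E_2` instead of the sup-norm cube).
So at the certified instance the `SU(N)` road has NO input beyond the `SU(2)` road's. NE7c NOT proved. [folklore] -/
theorem slotAntiConcentration_realized_suTwo_expJac (Λ : Finset (PBond P j)) {S : ℝ} (hS : 0 ≤ S)
    (hSπ : S ≤ Real.pi) (c : GaugeField P j (SUN 2) → GaugeField P j (SUN 2))
    {R : GaugeField P j (SUN 2) → (↥Λ → SUN 2) → ℝ≥0∞} (hR : ∀ V, Measurable (R V))
    {F : GaugeField P j (SUN 2) → ℝ≥0∞} (hF : Measurable F)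
    (hFw : ∀ V y, F (updateFinset V Λ y) = windowSU Λ (c V) S y * R V y)
    (hfin : ∀ V, ((blockLaw Λ).withDensity fun y => F (updateFinset V Λ y)) univ ≠ ∞)
    {u : GaugeField P j (SUN 2) → ℝ} (hu : Measurable u) {θ ρ a Bf D : ℝ} (hθ : 0 ≤ θ) (hρ : 0 ≤ ρ) (ha : 0 ≤ a)
    (haD : ((Λ.card * dimSU 2 : ℕ) + Bf) * a ≤ D * ρ)
    (hcore : ∀ V x, x ∈ closedBall (0 : BlockChartSU 2 Λ) S → R V (expFibreChartSU Λ (c V) x) ≠ 0 →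
      u (updateFinset V Λ (expFibreChartSU Λ (c V) x)) < θ →
      u (updateFinset V Λ (expFibreChartSU Λ (c V) (Real.exp (-a) • x))) < θ * (1 - ρ))
    (hden : ∀ V x, x ∈ closedBall (0 : BlockChartSU 2 Λ) S → R V (expFibreChartSU Λ (c V) x) ≠ 0 →
      u (updateFinset V Λ (expFibreChartSU Λ (c V) x)) < θ →
      R V (expFibreChartSU Λ (c V) x) ≤
        ENNReal.ofReal (Real.exp (Bf * a)) * R V (expFibreChartSU Λ (c V) (Real.exp (-a) • x))) :
    SlotAntiConcentration ((fieldMeasure P j (SUN 2)).withDensity F) u θ ρ D :=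
  slotAntiConcentration_realized_suN_expJac Λ hS hSπ kappaTwo (hCH_two hSπ) c hR hF hFw hfin hu hθ hρ ha haD
    hcore hden

end Engine

end Summit.QuantumFields.BalabanUV.T4Continuum.ShellMeasureExpHaarSU2

end
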